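import Summits.CriticalPhenomena.SAWScalingLimit.Theses.SAWTwistedSelfEnergy
import Literature.Probability.RandomPlanarGeometry.CurveTortuosity
import Literature.Probability.RandomPlanarGeometry.SAWRestrictionCovariance
import Literature.Probability.LatticeModels.LatticeInterface
import Summits.CriticalPhenomena.SAWScalingLimit.Theorems.SAWRenewalTightnessShellCrossingBoundSocketTransfer
import Summits.CriticalPhenomena.SAWScalingLimit.Theorems.SAWRenewalTightnessShellCrossingBoundOfPinchAway
import Summits.CriticalPhenomena.SAWScalingLimit.Theorems.SAWRenewalTightnessTightOfShellCrossing
import HarnessLib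

/-!
# `SAWTwistedSelfEnergy.EventualTight` from the unordered-Markov fibre atom UMA (line `SketchIdeator2_1881`)

Glue of the line `SketchIdeator2_1881` (card `unordered-markov-fibres`, crux stmt-CriticalPhenomena-1881), landed
as the registered stub `EventualTight_of_uma`: the ONE open statement of the line — the unordered-Markov fibre
atom UMA (for every fibre of the UNORDERED outside trace at radius `2s`, i.e. walks using the same lattice edges
among the edges having an endpoint at mesh distance `≥ 2s` from the centre, the JOINT event "`k` separate
traversals of the fine shell `D(y; ts, s)` but `< m` of the coarse shell `D(y; 6s/5, 2s)`" has mass `≤ θ ×`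
the fibre's mass, thresholds per `(D,a,b,y,s,t,m)`, eventual in `δ`) — implies the crux BY NAME.

Chain (all proved here or landed): fibre decomposition of the discrete critical SAW law along ANY map
(`law_fiber_decomp`, `law_le_add_of_fibrewise`: `P[A] ≤ P[C] + θ` from a fibrewise bound on `A ∩ Cᶜ`) ⇒ the
one-scale step (`fine_of_coarse_of_atom`: coarse tightness at `2s` + atom at `s` ⇒ fine tightness at `s`) ⇒
induction DOWN the scale ranges `(R₀/2ⁿ, R₀]` with the free base "shells reaching beyond `closure Ω` are never
traversed" (`not_hasTraversals_far`, `perShellDecay_of_uma`) ⇒ landed `Theorems.shellCrossing_of_perShellDecay`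
⇒ landed `Theorems.TightOfShellCrossing_proof` (Aizenman–Burchard criterion) ⇒ bridge
`isTightAlongMesh_of_isTightMeasureSet_image`.  No definition is introduced (the atom is inlined verbatim as
the hypothesis, = the registered signature of `stub_UMA`).

References: Aizenman–Burchard, Duke Math. J. 99 (1999) Thms 1.1–1.2 (tightness from shell-crossing bounds);
Kemppainen–Smirnov, Ann. Probab. 45 (2017) §2–3 (one-scale conditional crossing statements).
-/

noncomputable section

open MeasureTheory Filter Topology Set Metric
open scoped ENNReal NNReal unitInterval
open Literature.Probability.RandomPlanarGeometry Literature.Probability.LatticeModels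

namespace Summit.CriticalPhenomena.SAWScalingLimit.Theorems.EventualTightUMA

/-! ## Fibre decomposition of the critical SAW law -/

section Fibre

variable {Ω : Set ℂ} {δ : ℝ} {a b : Site 2}

/-- The critical SAW law of a set is the sum of its point masses (discrete σ-algebra). [folklore] -/
theorem law_apply_eq_tsum (S : Set (SAW.DomainSAW Ω δ a b)) :
    SAW.law Ω δ a b S = ∑' γ, S.indicator (fun γ => SAW.law Ω δ a b {γ}) γ := by
  rw [SAW.law_apply_eq_inv_mul_weight, SAW.weight_apply_eq_tsum_indicator Ω δ a b S,
    ← ENNReal.tsum_mul_left]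
  refine tsum_congr fun γ => ?_
  by_cases h : γ ∈ S
  · rw [Set.indicator_of_mem h, Set.indicator_of_mem h, SAW.law_apply_eq_inv_mul_weight,
      SAW.weight_singleton]
  · simp [h]

/-- Regrouping an `ℝ≥0∞`-sum along the fibres of a map. [folklore] -/
theorem tsum_eq_tsum_fibres {α β : Type*} (π : α → β) (g : α → ℝ≥0∞) :
    ∑' x, g x = ∑' L, ∑' x : {x // π x = L}, g x.1 := by
  rw [← (Equiv.sigmaFiberEquiv π).tsum_eq g, ENNReal.tsum_sigma']
  rfl

/-- A fibre sum of an indicator is the sum of the indicator of the fibre slice. [folklore] -/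
theorem tsum_fibre_indicator {α β : Type*} (π : α → β) (g : α → ℝ≥0∞) (S : Set α) (L : β) :
    ∑' x : {x // π x = L}, S.indicator g x.1 = ∑' x, ({x | π x = L} ∩ S).indicator g x := by
  rw [← Set.indicator_indicator]
  exact tsum_subtype ({x | π x = L} : Set α) (S.indicator g)

/-- **Fibre decomposition of the critical SAW law** along an arbitrary map `π` on walks. [folklore] -/
theorem law_fiber_decomp {β : Type*} (π : SAW.DomainSAW Ω δ a b → β) (S : Set (SAW.DomainSAW Ω δ a b)) :
    SAW.law Ω δ a b S = ∑' L : β, SAW.law Ω δ a b ({γ | π γ = L} ∩ S) := by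
  rw [law_apply_eq_tsum S, tsum_eq_tsum_fibres π]
  refine tsum_congr fun L => ?_
  rw [law_apply_eq_tsum ({γ | π γ = L} ∩ S)]
  exact tsum_fibre_indicator π _ S L

/-- The critical SAW law has total mass `≤ 1` (it is `0` or a probability measure). [folklore] -/
theorem law_univ_le_one : SAW.law Ω δ a b Set.univ ≤ 1 := by
  rw [SAW.law_apply_eq_inv_mul_weight]
  rcases eq_or_ne (SAW.weight Ω δ a b Set.univ) 0 with h | h
  · simp [h]
  rcases eq_or_ne (SAW.weight Ω δ a b Set.univ) ⊤ with h' | h'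
  · simp [h']
  · rw [ENNReal.inv_mul_cancel h h']

/-- **Core of the one-scale step**: a bound on the joint event `A ∩ Cᶜ` uniform over the fibres of a map `π`
(each fibre named by a reference walk `γ₀`) gives `P[A] ≤ P[C] + θ`. [folklore] -/
theorem law_le_add_of_fibrewise {β : Type*} (π : SAW.DomainSAW Ω δ a b → β)
    (A C : Set (SAW.DomainSAW Ω δ a b)) (θ : ℝ≥0∞)
    (hU : ∀ γ₀ : SAW.DomainSAW Ω δ a b,
      SAW.law Ω δ a b ({γ | π γ = π γ₀} ∩ (A ∩ Cᶜ)) ≤ θ * SAW.law Ω δ a b {γ | π γ = π γ₀}) :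
    SAW.law Ω δ a b A ≤ SAW.law Ω δ a b C + θ := by
  have hper : ∀ L : β, SAW.law Ω δ a b ({γ | π γ = L} ∩ (A ∩ Cᶜ)) ≤
      θ * SAW.law Ω δ a b ({γ | π γ = L} ∩ Set.univ) := by
    intro L
    rw [Set.inter_univ]
    by_cases hne : ∃ γ₀ : SAW.DomainSAW Ω δ a b, π γ₀ = L
    · obtain ⟨γ₀, hγ₀⟩ := hne
      rw [← hγ₀]
      exact hU γ₀
    · have hF : {γ : SAW.DomainSAW Ω δ a b | π γ = L} = ∅ :=
        Set.eq_empty_iff_forall_notMem.2 fun γ hγ => hne ⟨γ, hγ⟩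
      rw [hF, Set.empty_inter, measure_empty]
      exact bot_le
  have h3 : SAW.law Ω δ a b (A ∩ Cᶜ) ≤ θ := by
    calc SAW.law Ω δ a b (A ∩ Cᶜ)
        = ∑' L, SAW.law Ω δ a b ({γ | π γ = L} ∩ (A ∩ Cᶜ)) := law_fiber_decomp π _
      _ ≤ ∑' L, θ * SAW.law Ω δ a b ({γ | π γ = L} ∩ Set.univ) := ENNReal.tsum_le_tsum hper
      _ = θ * SAW.law Ω δ a b Set.univ := by
          rw [ENNReal.tsum_mul_left, ← law_fiber_decomp π Set.univ]
      _ ≤ θ * 1 := by gcongr; exact law_univ_le_one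
      _ = θ := mul_one _
  calc SAW.law Ω δ a b A ≤ SAW.law Ω δ a b (C ∪ (A ∩ Cᶜ)) :=
        measure_mono fun γ hγ => by
          by_cases hc : γ ∈ C
          · exact Or.inl hc
          · exact Or.inr ⟨hγ, hc⟩
    _ ≤ SAW.law Ω δ a b C + SAW.law Ω δ a b (A ∩ Cᶜ) := measure_union_le _ _
    _ ≤ SAW.law Ω δ a b C + θ := by gcongr

/-- Two walks agree on the edges with an endpoint at mesh distance `≥ r` from `y` iff their outside-edge
signatures coincide; so the fibres of the unordered outside trace are the fibres of the signature map.
[folklore] -/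
theorem outAgree_iff_sig_eq (y : ℂ) (r : ℝ) (γ γ₀ : SAW.DomainSAW Ω δ a b) :
    (∀ e : Sym2 (Site 2), (∃ v : Site 2, v ∈ e ∧ r ≤ dist (meshPoint δ v) y) →
        (e ∈ γ.walk.edges ↔ e ∈ γ₀.walk.edges)) ↔
      {e : Sym2 (Site 2) | (∃ v : Site 2, v ∈ e ∧ r ≤ dist (meshPoint δ v) y) ∧ e ∈ γ.walk.edges} =
        {e | (∃ v : Site 2, v ∈ e ∧ r ≤ dist (meshPoint δ v) y) ∧ e ∈ γ₀.walk.edges} := by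
  constructor
  · intro h
    ext e
    simp only [Set.mem_setOf_eq]
    exact ⟨fun ⟨he, hm⟩ => ⟨he, (h e he).1 hm⟩, fun ⟨he, hm⟩ => ⟨he, (h e he).2 hm⟩⟩
  · intro h e he
    have h' := Set.ext_iff.1 h e
    simp only [Set.mem_setOf_eq] at h'
    exact ⟨fun hm => (h'.1 ⟨he, hm⟩).2, fun hm => (h'.2 ⟨he, hm⟩).2⟩

end Fibre

/-! ## The one-scale step and the free base -/

/-- **The one-scale step** (one domain, one centre, one scale): eventual tightness of the COARSE count (shell
`D(y; 6s/5, 2s)`) and the fibrewise atom at scale `s` give eventual tightness of the FINE count (shell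
`D(y; ts, s)`): `P[T_fine ≥ k] ≤ P[T_coarse ≥ m] + θ` by `law_le_add_of_fibrewise` along the outside-edge
signature. [cite: KemppainenSmirnov2017, §2-3] -/
theorem fine_of_coarse_of_atom (D : DobrushinDomain) (a b : ℝ → Site 2) (y : ℂ) (s t : ℝ)
    (hC : ∀ ε : ℝ, 0 < ε → ∃ (m : ℕ) (δ₁ : ℝ), 0 < δ₁ ∧ ∀ δ ∈ Set.Ioc (0 : ℝ) δ₁,
      SAW.law D.carrier δ (a δ) (b δ)
        {γ | (⟨γ.walk.toCurve (meshPoint δ)⟩ : Curve ℂ).HasTraversals m y (6 * s / 5) (2 * s)} ≤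
        ENNReal.ofReal ε)
    (hU : ∀ (m : ℕ) (θ : ℝ), 0 < θ → ∃ (k : ℕ) (δ₀ : ℝ), 0 < δ₀ ∧ ∀ δ ∈ Set.Ioc (0 : ℝ) δ₀,
      ∀ γ₀ : SAW.DomainSAW D.carrier δ (a δ) (b δ),
        SAW.law D.carrier δ (a δ) (b δ)
            {γ | (∀ e : Sym2 (Site 2), (∃ v : Site 2, v ∈ e ∧ 2 * s ≤ dist (meshPoint δ v) y) →
                  (e ∈ γ.walk.edges ↔ e ∈ γ₀.walk.edges)) ∧
              (⟨γ.walk.toCurve (meshPoint δ)⟩ : Curve ℂ).HasTraversals k y (t * s) s ∧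
              ¬ (⟨γ.walk.toCurve (meshPoint δ)⟩ : Curve ℂ).HasTraversals m y (6 * s / 5) (2 * s)}
          ≤ ENNReal.ofReal θ *
            SAW.law D.carrier δ (a δ) (b δ)
              {γ | ∀ e : Sym2 (Site 2), (∃ v : Site 2, v ∈ e ∧ 2 * s ≤ dist (meshPoint δ v) y) →
                  (e ∈ γ.walk.edges ↔ e ∈ γ₀.walk.edges)}) :
    ∀ ε : ℝ, 0 < ε → ∃ (k : ℕ) (δ₁ : ℝ), 0 < δ₁ ∧ ∀ δ ∈ Set.Ioc (0 : ℝ) δ₁,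
      SAW.law D.carrier δ (a δ) (b δ)
        {γ | (⟨γ.walk.toCurve (meshPoint δ)⟩ : Curve ℂ).HasTraversals k y (t * s) s} ≤
        ENNReal.ofReal ε := by
  intro ε hε
  have hε2 : 0 < ε / 2 := by positivity
  obtain ⟨m, δ₁, hδ₁, hCm⟩ := hC (ε / 2) hε2
  obtain ⟨k, δ₀, hδ₀, hUk⟩ := hU m (ε / 2) hε2
  refine ⟨k, min δ₁ δ₀, lt_min hδ₁ hδ₀, fun δ hδ => ?_⟩
  have hδ1 : δ ∈ Set.Ioc (0 : ℝ) δ₁ := ⟨hδ.1, hδ.2.trans (min_le_left _ _)⟩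
  have hδ0 : δ ∈ Set.Ioc (0 : ℝ) δ₀ := ⟨hδ.1, hδ.2.trans (min_le_right _ _)⟩
  -- the outside-edge signature at radius `2s`
  set π : SAW.DomainSAW D.carrier δ (a δ) (b δ) → Set (Sym2 (Site 2)) := fun γ =>
    {e | (∃ v : Site 2, v ∈ e ∧ 2 * s ≤ dist (meshPoint δ v) y) ∧ e ∈ γ.walk.edges} with hπ
  set A : Set (SAW.DomainSAW D.carrier δ (a δ) (b δ)) :=
    {γ | (⟨γ.walk.toCurve (meshPoint δ)⟩ : Curve ℂ).HasTraversals k y (t * s) s} with hA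
  set C : Set (SAW.DomainSAW D.carrier δ (a δ) (b δ)) :=
    {γ | (⟨γ.walk.toCurve (meshPoint δ)⟩ : Curve ℂ).HasTraversals m y (6 * s / 5) (2 * s)} with hC'
  have hfib : ∀ γ₀ : SAW.DomainSAW D.carrier δ (a δ) (b δ),
      SAW.law D.carrier δ (a δ) (b δ) ({γ | π γ = π γ₀} ∩ (A ∩ Cᶜ)) ≤
        ENNReal.ofReal (ε / 2) * SAW.law D.carrier δ (a δ) (b δ) {γ | π γ = π γ₀} := by
    intro γ₀
    have h := hUk δ hδ0 γ₀
    have hF : {γ : SAW.DomainSAW D.carrier δ (a δ) (b δ) | π γ = π γ₀} =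
        {γ | ∀ e : Sym2 (Site 2), (∃ v : Site 2, v ∈ e ∧ 2 * s ≤ dist (meshPoint δ v) y) →
          (e ∈ γ.walk.edges ↔ e ∈ γ₀.walk.edges)} := by
      ext γ
      simp only [Set.mem_setOf_eq, hπ]
      exact (outAgree_iff_sig_eq y (2 * s) γ γ₀).symm
    have hset : ({γ : SAW.DomainSAW D.carrier δ (a δ) (b δ) | π γ = π γ₀} ∩ (A ∩ Cᶜ)) =
        {γ | (∀ e : Sym2 (Site 2), (∃ v : Site 2, v ∈ e ∧ 2 * s ≤ dist (meshPoint δ v) y) →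
              (e ∈ γ.walk.edges ↔ e ∈ γ₀.walk.edges)) ∧
          (⟨γ.walk.toCurve (meshPoint δ)⟩ : Curve ℂ).HasTraversals k y (t * s) s ∧
          ¬ (⟨γ.walk.toCurve (meshPoint δ)⟩ : Curve ℂ).HasTraversals m y (6 * s / 5) (2 * s)} := by
      rw [hF]
      ext γ
      simp only [Set.mem_inter_iff, Set.mem_setOf_eq, Set.mem_compl_iff, hA, hC']
    rw [hset, hF]
    exact h
  calc SAW.law D.carrier δ (a δ) (b δ) A
      ≤ SAW.law D.carrier δ (a δ) (b δ) C + ENNReal.ofReal (ε / 2) :=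
        law_le_add_of_fibrewise π A C _ hfib
    _ ≤ ENNReal.ofReal (ε / 2) + ENNReal.ofReal (ε / 2) := by gcongr; exact hCm δ hδ1
    _ = ENNReal.ofReal ε := by rw [← ENNReal.ofReal_add hε2.le hε2.le, add_halves]

/-- **No traversal of a far shell.**  If `closure Ω ⊆ B(y, R₀)` then no SAW polyline of `Ω_δ` makes even one
traversal of a genuine shell `D(y; r, R)` with `R₀ ≤ R`: the outer endpoint of a traversal is a polyline point
at distance `≥ R` from `y`, while every polyline point lies in `closure Ω` (or the polyline is constant), by the
landed `exists_mem_closure_of_hasTraversals` applied to the one-strand traversal of `D(p; 0, R − r)`. [folklore] -/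
theorem not_hasTraversals_far {Ω : Set ℂ} {δ : ℝ} {a b : Site 2} {y : ℂ} {R₀ r R : ℝ}
    (hΩ : closure Ω ⊆ Metric.ball y R₀) (hrR : r < R) (hR : R₀ ≤ R)
    (γ : SAW.DomainSAW Ω δ a b) {k : ℕ} (hk : k ≠ 0) :
    ¬ (⟨γ.walk.toCurve (meshPoint δ)⟩ : Curve ℂ).HasTraversals k y r R := by
  rintro ⟨s, t, hst, -⟩
  obtain ⟨i⟩ : Nonempty (Fin k) := Fin.pos_iff_nonempty.1 (Nat.pos_of_ne_zero hk)
  have hRr : (0 : ℝ) < R - r := by linarith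
  set c : Curve ℂ := ⟨γ.walk.toCurve (meshPoint δ)⟩ with hc
  have main : ∀ p : ℂ, (∃ z ∈ closure Ω, dist z p ≤ 0) → R ≤ dist p y → False := by
    rintro p ⟨z, hz, hzp⟩ hp
    have hzp' : z = p := dist_le_zero.1 hzp
    subst hzp'
    have hb := hΩ hz
    rw [Metric.mem_ball] at hb
    linarith
  have hsep : ∀ ⦃j j' : Fin 1⦄, j < j' → (fun _ : Fin 1 => t i) j < (fun _ : Fin 1 => s i) j' := by
    intro j j' hjj'
    exact absurd hjj' (by rw [Subsingleton.elim j j']; exact lt_irrefl _)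
  rcases (hst i).2 with ⟨h1, h2⟩ | ⟨h1, h2⟩
  · refine main (c (t i)) ?_ h2
    refine exists_mem_closure_of_hasTraversals γ.walk one_ne_zero hRr ?_
    refine ⟨fun _ => s i, fun _ => t i, fun _ => ⟨(hst i).1, Or.inr ⟨?_, ?_⟩⟩, hsep⟩
    · have htri := dist_triangle (c (t i)) (c (s i)) y
      rw [dist_comm (c (t i)) (c (s i))] at htri
      show R - r ≤ dist (c (s i)) (c (t i))
      linarith
    · show dist (c (t i)) (c (t i)) ≤ 0
      rw [dist_self]
  · refine main (c (s i)) ?_ h1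
    refine exists_mem_closure_of_hasTraversals γ.walk one_ne_zero hRr ?_
    refine ⟨fun _ => s i, fun _ => t i, fun _ => ⟨(hst i).1, Or.inl ⟨?_, ?_⟩⟩, hsep⟩
    · show dist (c (s i)) (c (s i)) ≤ 0
      rw [dist_self]
    · have htri := dist_triangle (c (s i)) (c (t i)) y
      show R - r ≤ dist (c (t i)) (c (s i))
      rw [dist_comm (c (t i)) (c (s i))]
      linarith

/-! ## Per-shell decay from the atom, and the crux -/

/-- **UMA ⇒ per-shell eventual tightness of the traversal count, for EVERY shell.**  Fix `(D,a,b)` and the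
centre `x`; take `R₀` with `closure Ω ⊆ B(x, R₀)`.  Shells with outer radius `≥ R₀` are never traversed
(`not_hasTraversals_far`).  For the others induct on `n` over the scale ranges `s ∈ (R₀/2ⁿ, R₀]`: the coarse
shell `D(x; 6s/5, 2s)` of the step at scale `s` either has outer radius `2s ≥ R₀` or is the target `t = 3/5`
at scale `2s` of the previous range; the step is `fine_of_coarse_of_atom`.  An arbitrary shell `D(x; ρ, R)`
with `R < R₀` is the shell `t = ρ/R` at scale `R`. [cite: AizenmanBurchardDuke1999, Thms 1.1-1.2] -/
theorem perShellDecay_of_uma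
    (hUMA : ∀ (D : DobrushinDomain) (a b : ℝ → Site 2), SAW.IsEndpointApprox D a b →
      ∀ (y : ℂ) (s t : ℝ), 0 < s → 0 < t → t < 1 → ∀ (m : ℕ) (θ : ℝ), 0 < θ →
        ∃ (k : ℕ) (δ₀ : ℝ), 0 < δ₀ ∧ ∀ δ ∈ Set.Ioc (0 : ℝ) δ₀,
          ∀ γ₀ : SAW.DomainSAW D.carrier δ (a δ) (b δ),
            SAW.law D.carrier δ (a δ) (b δ)
                {γ | (∀ e : Sym2 (Site 2), (∃ v : Site 2, v ∈ e ∧ 2 * s ≤ dist (meshPoint δ v) y) →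
                      (e ∈ γ.walk.edges ↔ e ∈ γ₀.walk.edges)) ∧
                  (⟨γ.walk.toCurve (meshPoint δ)⟩ : Curve ℂ).HasTraversals k y (t * s) s ∧
                  ¬ (⟨γ.walk.toCurve (meshPoint δ)⟩ : Curve ℂ).HasTraversals m y (6 * s / 5) (2 * s)}
              ≤ ENNReal.ofReal θ *
                SAW.law D.carrier δ (a δ) (b δ)
                  {γ | ∀ e : Sym2 (Site 2), (∃ v : Site 2, v ∈ e ∧ 2 * s ≤ dist (meshPoint δ v) y) →
                      (e ∈ γ.walk.edges ↔ e ∈ γ₀.walk.edges)})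
    (D : DobrushinDomain) (a b : ℝ → Site 2) (hab : SAW.IsEndpointApprox D a b) :
    ∀ (x : ℂ) (ρ R : ℝ), 0 < ρ → ρ < R → ∀ ε : ℝ, 0 < ε →
      ∃ (k : ℕ) (δ₁ : ℝ), 0 < δ₁ ∧ ∀ δ ∈ Set.Ioc (0 : ℝ) δ₁,
        SAW.law D.carrier δ (a δ) (b δ)
          {γ | (⟨γ.walk.toCurve (meshPoint δ)⟩ : Curve ℂ).HasTraversals k x ρ R} ≤ ENNReal.ofReal ε := by
  intro x ρ R hρ hρR ε hε
  obtain ⟨R₁, hR₁⟩ := (D.isBounded.closure).subset_ball x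
  set R₀ : ℝ := max R₁ 1 with hR₀def
  have hR₀pos : 0 < R₀ := lt_of_lt_of_le one_pos (le_max_right _ _)
  have hΩ : closure D.carrier ⊆ Metric.ball x R₀ :=
    hR₁.trans (Metric.ball_subset_ball (le_max_left _ _))
  -- far shells: never traversed
  have htriv : ∀ r R' : ℝ, r < R' → R₀ ≤ R' → ∀ ε' : ℝ, 0 < ε' →
      ∃ (k : ℕ) (δ₁ : ℝ), 0 < δ₁ ∧ ∀ δ ∈ Set.Ioc (0 : ℝ) δ₁,
        SAW.law D.carrier δ (a δ) (b δ)
          {γ | (⟨γ.walk.toCurve (meshPoint δ)⟩ : Curve ℂ).HasTraversals k x r R'} ≤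
          ENNReal.ofReal ε' := by
    intro r R' hrR' hR' ε' _
    refine ⟨1, 1, one_pos, fun δ _ => ?_⟩
    have hempty : {γ : SAW.DomainSAW D.carrier δ (a δ) (b δ) |
        (⟨γ.walk.toCurve (meshPoint δ)⟩ : Curve ℂ).HasTraversals 1 x r R'} = ∅ :=
      Set.eq_empty_iff_forall_notMem.2 fun γ hγ =>
        not_hasTraversals_far hΩ hrR' hR' γ one_ne_zero hγ
    rw [hempty, measure_empty]
    exact bot_le
  -- the induction over scale ranges
  have hclaim : ∀ n : ℕ, ∀ s : ℝ, R₀ / 2 ^ n < s → s ≤ R₀ → ∀ t : ℝ, 0 < t → t < 1 →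
      ∀ ε' : ℝ, 0 < ε' → ∃ (k : ℕ) (δ₁ : ℝ), 0 < δ₁ ∧ ∀ δ ∈ Set.Ioc (0 : ℝ) δ₁,
        SAW.law D.carrier δ (a δ) (b δ)
          {γ | (⟨γ.walk.toCurve (meshPoint δ)⟩ : Curve ℂ).HasTraversals k x (t * s) s} ≤
          ENNReal.ofReal ε' := by
    intro n
    induction n with
    | zero =>
      intro s hs1 hs2
      rw [pow_zero, div_one] at hs1
      exact absurd hs2 (not_le.2 hs1)
    | succ n ih =>
      intro s hs1 hs2 t ht ht1
      have hs0 : 0 < s := lt_trans (div_pos hR₀pos (pow_pos two_pos _)) hs1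
      refine fine_of_coarse_of_atom D a b x s t ?_ (hUMA D a b hab x s t hs0 ht ht1)
      by_cases h2s : R₀ ≤ 2 * s
      · exact htriv (6 * s / 5) (2 * s) (by linarith) h2s
      · push Not at h2s
        have hrange : R₀ / 2 ^ n < 2 * s := by
          have e : R₀ / 2 ^ n = 2 * (R₀ / 2 ^ (n + 1)) := by
            rw [pow_succ]
            field_simp
          rw [e]
          linarith
        have h := ih (2 * s) hrange h2s.le (3 / 5) (by norm_num) (by norm_num)
        have e : (3 : ℝ) / 5 * (2 * s) = 6 * s / 5 := by ring
        rw [e] at h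
        exact h
  -- the given shell
  by_cases hfarR : R₀ ≤ R
  · exact htriv ρ R hρR hfarR ε hε
  · push Not at hfarR
    have hRpos : 0 < R := hρ.trans hρR
    obtain ⟨n, hn⟩ : ∃ n : ℕ, R₀ / 2 ^ n < R := by
      obtain ⟨n, hn⟩ := exists_pow_lt_of_lt_one (div_pos hRpos hR₀pos) (by norm_num : (1 : ℝ) / 2 < 1)
      refine ⟨n, ?_⟩
      have h1 : R₀ / 2 ^ n = R₀ * (1 / 2) ^ n := by
        rw [div_eq_mul_inv, one_div, inv_pow]
      rw [h1]
      calc R₀ * (1 / 2) ^ n < R₀ * (R / R₀) := mul_lt_mul_of_pos_left hn hR₀pos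
        _ = R := by field_simp
    have h := hclaim n R hn hfarR.le (ρ / R) (div_pos hρ hRpos) ((div_lt_one hRpos).2 hρR) ε hε
    have e : ρ / R * R = ρ := by field_simp
    rw [e] at h
    exact h

/-- **`SAWTwistedSelfEnergy.EventualTight` from the unordered-Markov fibre atom** (registered stub
`EventualTight_of_uma` of stmt-CriticalPhenomena-1881; the hypothesis is the registered signature of the line's
one open stub `stub_UMA`, verbatim): per-shell tightness (`perShellDecay_of_uma`) ⇒ `ShellCrossingBound` form
(landed `shellCrossing_of_perShellDecay`) ⇒ set-form eventual tightness (landed `TightOfShellCrossing_proof`,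
Aizenman–Burchard) ⇒ the along-the-mesh crux (bridge `isTightAlongMesh_of_isTightMeasureSet_image`, the SAW
curve observable being measurable at every mesh). [cite: AizenmanBurchardDuke1999, Thms 1.1-1.2] -/
theorem EventualTight_of_uma :
    (∀ (D : Literature.Probability.RandomPlanarGeometry.DobrushinDomain)
      (a b : ℝ → Literature.Probability.LatticeModels.Site 2),
      Literature.Probability.RandomPlanarGeometry.SAW.IsEndpointApprox D a b →
      ∀ (y : ℂ) (s t : ℝ), 0 < s → 0 < t → t < 1 → ∀ (m : ℕ) (θ : ℝ), 0 < θ →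
        ∃ (k : ℕ) (δ₀ : ℝ), 0 < δ₀ ∧ ∀ δ ∈ Set.Ioc (0 : ℝ) δ₀,
          ∀ γ₀ : Literature.Probability.RandomPlanarGeometry.SAW.DomainSAW D.carrier δ (a δ) (b δ),
            Literature.Probability.RandomPlanarGeometry.SAW.law D.carrier δ (a δ) (b δ)
                {γ | (∀ e : Sym2 (Literature.Probability.LatticeModels.Site 2),
                    (∃ v : Literature.Probability.LatticeModels.Site 2,
                      v ∈ e ∧ 2 * s ≤ dist (Literature.Probability.LatticeModels.meshPoint δ v) y) →
                    (e ∈ γ.walk.edges ↔ e ∈ γ₀.walk.edges)) ∧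
                  (⟨γ.walk.toCurve (Literature.Probability.LatticeModels.meshPoint δ)⟩ :
                      Literature.Probability.RandomPlanarGeometry.Curve ℂ).HasTraversals k y (t * s) s ∧
                  ¬ (⟨γ.walk.toCurve (Literature.Probability.LatticeModels.meshPoint δ)⟩ :
                      Literature.Probability.RandomPlanarGeometry.Curve ℂ).HasTraversals m y (6 * s / 5)
                      (2 * s)} ≤
              ENNReal.ofReal θ *
                Literature.Probability.RandomPlanarGeometry.SAW.law D.carrier δ (a δ) (b δ)
                  {γ | ∀ e : Sym2 (Literature.Probability.LatticeModels.Site 2),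
                    (∃ v : Literature.Probability.LatticeModels.Site 2,
                      v ∈ e ∧ 2 * s ≤ dist (Literature.Probability.LatticeModels.meshPoint δ v) y) →
                    (e ∈ γ.walk.edges ↔ e ∈ γ₀.walk.edges)}) →
      Summit.CriticalPhenomena.SAWScalingLimit.Theses.SAWTwistedSelfEnergy.EventualTight := by
  intro hUMA
  have hSCB : Summit.CriticalPhenomena.SAWScalingLimit.Theses.SAWRenewalTightness.ShellCrossingBound :=
    fun D a b hab => shellCrossing_of_perShellDecay D a b (perShellDecay_of_uma hUMA D a b hab)
  have hT := TightOfShellCrossing_proof hSCB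
  intro D a b hab
  obtain ⟨δ₀, hδ₀, hTight⟩ := hT D a b hab
  exact isTightAlongMesh_of_isTightMeasureSet_image
    (Eventually.of_forall fun δ => SAW.aemeasurable_curve D.carrier δ (a δ) (b δ)) hδ₀ hTight

end Summit.CriticalPhenomena.SAWScalingLimit.Theorems.EventualTightUMA

end
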